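import Summits.ABC.IUTFork.Conditional.FreyLegendreP6EngineList
import Literature.NumberTheory.EllipticCurves.PointCountEulerCriterion
import Literature.NumberTheory.EllipticCurves.ComplexMultiplicationLocalFactorsAux
import HarnessLib

/-!
# (P6) IN KERNEL at the Frey–Legendre data HEX λ_13 = 1/2 + 2/7¹³ = (7¹³+4)/(2·7¹³) (5 tabulated l) · HEX λ_14 = 1/2 + 2/7¹⁴ = (7¹⁴+4)/(2·7¹⁴) (5 tabulated l) — every prime `l` tabulated in the R-W WINDOW-TABLE

PROOF-ONLY file (D-0012; 0 definitions, 0 `Prop` facts, no instance, no notation) of the abc-iut cell (seat abc-iut-w6-d102, gen 5;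
row «C:P6-KERNEL-N3» = the N3 universe of plan/rescue/R-W/WINDOW-TABLE.tsv v4.25 (abc-iut-rw-num-lead), whose column «admissible»
reads «P6: Serre-witnessed (W-num-3, p ≤ 37; kernel: NOT certified)» at these data). For each datum `λ = a/c` below (spelled VERBATIM
as in the tree's K/M rows) and EVERY tabulated prime `l`, `Cor22.CondP6 (ratPoint λ) l` — the image of `Gal(F̄/F)` on `E_F[l]`
contains `SL₂(𝔽_l)` for every theta-field `F` ([IUTchIV] Cor. 2.2 (ii) (P6) p. 46 / [IUTchI] Def. 3.1 (c)) — is a THEOREM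
(`<Tag>.condP6_tabulated`), by the LIST ENGINE `FreyP6Engine.condP6_ratPoint_of_certificate_list` (p484675) on the integer model
`E₁ = [0, −(c²+ac), 0, ac³, 0]` of `y² = x(x−1)(x−λ)`: ONE multiplicative prime `q ∣ ab` (`q ∤ c₄(E₁)`, `Δ(E₁) = 16a²c⁸b² = q^k·D`,
`q ∤ D`), a few good primes `p` with KERNEL point counts `#Ẽ₁(𝔽_p)` (Euler's criterion) hence `a_p`, and per certificate prime ONE
`decide +kernel` for the side conditions `l.Prime ∧ l ∤ 46080 ∧ q ∤ l ∧ l ∤ k ∧ p ≠ l` and ONE for the `ℕ`-rootlessness of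
`X² − a_pX + p` mod every listed `l` (Mazur's Frobenius certificate ⇒ `ρ̄_l` irreducible; Tate transvection at `q` ⇒ `⊇ SL₂(𝔽_l)`).

* **HEX λ_13 = 1/2 + 2/7¹³ = (7¹³+4)/(2·7¹³) (5 tabulated l)**: `ratPoint (((7 ^ 13 + 4 : ℕ) : ℚ) / (2 * 7 ^ 13 : ℕ))`, 5 primes `11 ≤ l ≤ 223`; multiplicative
  prime(s) [3]; certificates p = 5: E₁ mod 5 = [0,0,0,4,0], #Ẽ₁ = 8, a_5 = -2; p = 11: E₁ mod 11 = [0,4,0,10,0], #Ẽ₁ = 16, a_11 = -4.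
* **HEX λ_14 = 1/2 + 2/7¹⁴ = (7¹⁴+4)/(2·7¹⁴) (5 tabulated l)**: `ratPoint (((7 ^ 14 + 4 : ℕ) : ℚ) / (2 * 7 ^ 14 : ℕ))`, 5 primes `11 ≤ l ≤ 239`; multiplicative
  prime(s) [3]; certificates p = 11: E₁ mod 11 = [0,10,0,5,0], #Ẽ₁ = 16, a_11 = -4; p = 13: E₁ mod 13 = [0,9,0,5,0], #Ẽ₁ = 8, a_13 = 6.

K2 (C-R66 (c)): source #1 = this seat's generator `p6gen.py` (HOME/staging/w6/w6-d102/g5/; two independent code paths per prime —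
`y`-enumeration and Euler-criterion column sum — agree on every `#Ẽ₁(𝔽_p)`; per-datum tables `K2-<tag>.txt` staged alongside);
source #2 = abc-iut-W-num-3's Serre-witness column of WINDOW-TABLE v4.25 (desk `p ≤ 37` witnesses at the same data). The kernel's
`decide` is the arbiter of every number in this file.

HONEST SCOPE: classical, undisputed arithmetic of one elliptic curve over `ℚ` per datum (Serre 1972 / Mazur 1978 / a Tate transvection);
it turns the table's (P6) column at these data into kernel theorems (hence, with (P2)/(P5)/core/`UP` as typed, the datum types
`ThetaVolumeDatumAt (ratPoint λ) l` are inhabited via `ThetaPartII.stub_thetaData` — the non-vacuity input of the «refuted by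
unconditional theorem» rows), nothing more; nothing here is about Θ-data or [IUTchIII] Cor. 3.12; refuted-as-typed ≠ refuted-in-print;
no side taken on any author; typed ≠ proved for every IUT sentence; no abc claim.
[cite: Mochizuki2012, IUTchIV Cor. 2.2 (ii) proof (P6) p. 46; IUTchI Def. 3.1 (c) p. 62] [cite: Mazur1978, §6 Prop. 6.3 (1) p. 153]
[cite: MochizukiGenEll2010, Lem. 3.1 (iii) p. 14] [cite: SilvermanAEC2009, VII.5 Prop. 5.1(b), III.1 Table 3.1]
[claim: Mochizuki2012, status: disputed] for every IUT quotation.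
-/

noncomputable section

open scoped Classical
open WeierstrassCurve

namespace Summit.ABC.IUTFork.Conditional

open Literature.NumberTheory.EllipticCurves Literature.NumberTheory.DiophantineGeometry.GenEll
open Literature.NumberTheory.DiophantineGeometry Literature.IUT.LogVolume
namespace FreyP6Hex13

/-! ## Datum `λ = (7 ^ 13 + 4)/(2 * 7 ^ 13)` (`a + b = c` with `b = c − a`); model `E₁ = [0, −(c²+ac), 0, ac³, 0]` -/

/-- `3 ∤ c₄(E₁)` (`c₄ = 16c²(c²−ac+a²)`, `3 ∣ b = c − a`, `gcd(a,c) = 1`). [cite: SilvermanAEC2009, VII.5 Prop. 5.1(b)] -/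
theorem not_dvd_c₄_3 : ¬ ((3 : ℕ) : ℤ) ∣ ((
      ⟨0, -(((2 * 7 ^ 13 : ℕ) : ℤ) ^ 2 + (7 ^ 13 + 4 : ℕ) * (2 * 7 ^ 13 : ℕ)), 0,
        ((7 ^ 13 + 4 : ℕ) : ℤ) * ((2 * 7 ^ 13 : ℕ) : ℤ) ^ 3, 0⟩ : WeierstrassCurve ℤ)).c₄ := by
  rw [FreyP6Engine.c₄_model]; norm_num

/-- `Δ(E₁) = 16a²c⁸b² = 3^2 · D` (`ord_3 b = 1`). [cite: SilvermanAEC2009, III.1 Table 3.1] -/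
theorem Δ_eq_3 : ((
      ⟨0, -(((2 * 7 ^ 13 : ℕ) : ℤ) ^ 2 + (7 ^ 13 + 4 : ℕ) * (2 * 7 ^ 13 : ℕ)), 0,
        ((7 ^ 13 + 4 : ℕ) : ℤ) * ((2 * 7 ^ 13 : ℕ) : ℤ) ^ 3, 0⟩ : WeierstrassCurve ℤ)).Δ =
      (3 : ℕ) ^ 2 * (16 * ((7 ^ 13 + 4 : ℕ) : ℤ) ^ 2 * ((2 * 7 ^ 13 : ℕ) : ℤ) ^ 8 * (32296336801 : ℤ) ^ 2) := by
  rw [FreyP6Engine.Δ_model]; norm_num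

/-- `3 ∤ D`. [folklore] -/
theorem not_dvd_D_3 : ¬ ((3 : ℕ) : ℤ) ∣ (16 * ((7 ^ 13 + 4 : ℕ) : ℤ) ^ 2 * ((2 * 7 ^ 13 : ℕ) : ℤ) ^ 8 * (32296336801 : ℤ) ^ 2) := by
  norm_num

/-- `a_5(E₁) = 5 + 1 − #Ẽ₁(𝔽_5) = 5 + 1 − 8 = -2`: `E₁ mod 5 = [0, 0, 0, 4, 0]` (`decide +kernel`) and the point count
`#Ẽ₁(𝔽_5) = 8` is a KERNEL computation (Euler's criterion, `card_sol_eq_sum_euler` / `natCard_point_eq_one_add_card`). [folklore] -/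
theorem frobeniusTrace_5 : Literature.NumberTheory.Automorphic.frobeniusTrace
    (
      ⟨0, -(((2 * 7 ^ 13 : ℕ) : ℤ) ^ 2 + (7 ^ 13 + 4 : ℕ) * (2 * 7 ^ 13 : ℕ)), 0,
        ((7 ^ 13 + 4 : ℕ) : ℤ) * ((2 * 7 ^ 13 : ℕ) : ℤ) ^ 3, 0⟩ : WeierstrassCurve ℤ) 5 = -2 := by
  have hm : ((
      ⟨0, -(((2 * 7 ^ 13 : ℕ) : ℤ) ^ 2 + (7 ^ 13 + 4 : ℕ) * (2 * 7 ^ 13 : ℕ)), 0,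
        ((7 ^ 13 + 4 : ℕ) : ℤ) * ((2 * 7 ^ 13 : ℕ) : ℤ) ^ 3, 0⟩ : WeierstrassCurve ℤ)).map (Int.castRingHom (ZMod 5)) = ⟨0, 0, 0, 4, 0⟩ := by
    ext <;> decide +kernel
  have hc : Nat.card (⟨0, 0, 0, 4, 0⟩ : WeierstrassCurve (ZMod 5)).toAffine.Point = 8 := by
    rw [@WeierstrassCurve.natCard_point_eq_one_add_card (ZMod 5) (@ZMod.instField 5 ⟨by norm_num⟩) _ _ _
      (by decide +kernel), @card_sol_eq_sum_euler (ZMod 5) (@ZMod.instField 5 ⟨by norm_num⟩) _ _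
      (by rw [ZMod.ringChar_zmod_n]; decide)]
    decide +kernel
  rw [Literature.NumberTheory.Automorphic.frobeniusTrace, Literature.NumberTheory.Automorphic.numPointsMod,
    hm, hc]; norm_num

/-- `a_11(E₁) = 11 + 1 − #Ẽ₁(𝔽_11) = 11 + 1 − 16 = -4`: `E₁ mod 11 = [0, 4, 0, 10, 0]` (`decide +kernel`) and the point count
`#Ẽ₁(𝔽_11) = 16` is a KERNEL computation (Euler's criterion, `card_sol_eq_sum_euler` / `natCard_point_eq_one_add_card`). [folklore] -/
theorem frobeniusTrace_11 : Literature.NumberTheory.Automorphic.frobeniusTrace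
    (
      ⟨0, -(((2 * 7 ^ 13 : ℕ) : ℤ) ^ 2 + (7 ^ 13 + 4 : ℕ) * (2 * 7 ^ 13 : ℕ)), 0,
        ((7 ^ 13 + 4 : ℕ) : ℤ) * ((2 * 7 ^ 13 : ℕ) : ℤ) ^ 3, 0⟩ : WeierstrassCurve ℤ) 11 = -4 := by
  have hm : ((
      ⟨0, -(((2 * 7 ^ 13 : ℕ) : ℤ) ^ 2 + (7 ^ 13 + 4 : ℕ) * (2 * 7 ^ 13 : ℕ)), 0,
        ((7 ^ 13 + 4 : ℕ) : ℤ) * ((2 * 7 ^ 13 : ℕ) : ℤ) ^ 3, 0⟩ : WeierstrassCurve ℤ)).map (Int.castRingHom (ZMod 11)) = ⟨0, 4, 0, 10, 0⟩ := by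
    ext <;> decide +kernel
  have hc : Nat.card (⟨0, 4, 0, 10, 0⟩ : WeierstrassCurve (ZMod 11)).toAffine.Point = 16 := by
    rw [@WeierstrassCurve.natCard_point_eq_one_add_card (ZMod 11) (@ZMod.instField 11 ⟨by norm_num⟩) _ _ _
      (by decide +kernel), @card_sol_eq_sum_euler (ZMod 11) (@ZMod.instField 11 ⟨by norm_num⟩) _ _
      (by rw [ZMod.ringChar_zmod_n]; decide)]
    decide +kernel
  rw [Literature.NumberTheory.Automorphic.frobeniusTrace, Literature.NumberTheory.Automorphic.numPointsMod,
    hm, hc]; norm_num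

/-- **(P6) at `ratPoint (((7 ^ 13 + 4 : ℕ) : ℚ) / (2 * 7 ^ 13 : ℕ))` for `l ∈ [11, 19, 23, 223]`** —
multiplicative prime `3` (`ord Δ = 2`), Frobenius certificate `p = 5` (`a_5 = -2`; `X² − a_5X + 5` rootless mod each
listed `l`, ONE kernel `decide` over `ℕ`). [cite: Mochizuki2012, IUTchIV Cor. 2.2 (ii) (P6) p.46] -/
theorem condP6_of_mem_q3_p5 :
    ∀ l ∈ ([11, 19, 23, 223] : List ℕ),
      Cor22.CondP6 (ratPoint (((7 ^ 13 + 4 : ℕ) : ℚ) / (2 * 7 ^ 13 : ℕ))) l :=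
  FreyP6Engine.condP6_ratPoint_of_certificate_list (7 ^ 13 + 4) (2 * 7 ^ 13) (by norm_num) (by norm_num) (by norm_num)
    3 (by norm_num) not_dvd_c₄_3 2 (by norm_num) _ Δ_eq_3 not_dvd_D_3 5 (by norm_num) (by rw [FreyP6Engine.Δ_model]; norm_num) (-2) frobeniusTrace_5
    [11, 19, 23, 223] (by decide +kernel) (by decide +kernel)

/-- **(P6) at `ratPoint (((7 ^ 13 + 4 : ℕ) : ℚ) / (2 * 7 ^ 13 : ℕ))` for `l ∈ [17]`** —
multiplicative prime `3` (`ord Δ = 2`), Frobenius certificate `p = 11` (`a_11 = -4`; `X² − a_11X + 11` rootless mod each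
listed `l`, ONE kernel `decide` over `ℕ`). [cite: Mochizuki2012, IUTchIV Cor. 2.2 (ii) (P6) p.46] -/
theorem condP6_of_mem_q3_p11 :
    ∀ l ∈ ([17] : List ℕ),
      Cor22.CondP6 (ratPoint (((7 ^ 13 + 4 : ℕ) : ℚ) / (2 * 7 ^ 13 : ℕ))) l :=
  FreyP6Engine.condP6_ratPoint_of_certificate_list (7 ^ 13 + 4) (2 * 7 ^ 13) (by norm_num) (by norm_num) (by norm_num)
    3 (by norm_num) not_dvd_c₄_3 2 (by norm_num) _ Δ_eq_3 not_dvd_D_3 11 (by norm_num) (by rw [FreyP6Engine.Δ_model]; norm_num) (-4) frobeniusTrace_11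
    [17] (by decide +kernel) (by decide +kernel)

/-- **(P6) HOLDS at `ratPoint (((7 ^ 13 + 4 : ℕ) : ℚ) / (2 * 7 ^ 13 : ℕ))` for EVERY tabulated `l`** of the R-W WINDOW-TABLE at this datum (5 primes,
`11 ≤ l ≤ 223`): `Cor22.CondP6 (ratPoint λ) l` — the image of `Gal(F̄/F)` on `E_F[l]` contains `SL₂(𝔽_l)` for every theta-field `F`.
Certificate primes [5, 11]; multiplicative prime(s) [3]. [cite: Mochizuki2012, IUTchIV Cor. 2.2 (ii) (P6) p.46] -/
theorem condP6_tabulated' :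
    ∀ l ∈ ([11, 17, 19, 23, 223] : List ℕ),
      Cor22.CondP6 (ratPoint (((7 ^ 13 + 4 : ℕ) : ℚ) / (2 * 7 ^ 13 : ℕ))) l := by
  have hsplit : ∀ l ∈ ([11, 17, 19, 23, 223] : List ℕ),
      l ∈ ([11, 19, 23, 223] : List ℕ) ∨
      l ∈ ([17] : List ℕ) := by
    decide +kernel
  intro l hl
  rcases hsplit l hl with h | h
  · exact condP6_of_mem_q3_p5 l h
  · exact condP6_of_mem_q3_p11 l h

/-- **(P6) at `ratPoint ((2 : ℚ)⁻¹ + 2 / 7 ^ 13)`** — the tree's spelling of this datum (`(2 : ℚ)⁻¹ + 2 / 7 ^ 13 = (7 ^ 13 + 4)/(2 * 7 ^ 13)`, `norm_num`) — for every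
tabulated `l`: `condP6_tabulated'` transported along the equality of the rational numbers. [cite: Mochizuki2012, IUTchIV Cor. 2.2 (ii) (P6) p.46] -/
theorem condP6_tabulated :
    ∀ l ∈ ([11, 17, 19, 23, 223] : List ℕ),
      Cor22.CondP6 (ratPoint ((2 : ℚ)⁻¹ + 2 / 7 ^ 13)) l := by
  have hq : ((2 : ℚ)⁻¹ + 2 / 7 ^ 13) = (((7 ^ 13 + 4 : ℕ) : ℚ) / (2 * 7 ^ 13 : ℕ)) := by norm_num
  rw [hq]
  exact condP6_tabulated'

end FreyP6Hex13

namespace FreyP6Hex14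

/-! ## Datum `λ = (7 ^ 14 + 4)/(2 * 7 ^ 14)` (`a + b = c` with `b = c − a`); model `E₁ = [0, −(c²+ac), 0, ac³, 0]` -/

/-- `3 ∤ c₄(E₁)` (`c₄ = 16c²(c²−ac+a²)`, `3 ∣ b = c − a`, `gcd(a,c) = 1`). [cite: SilvermanAEC2009, VII.5 Prop. 5.1(b)] -/
theorem not_dvd_c₄_3 : ¬ ((3 : ℕ) : ℤ) ∣ ((
      ⟨0, -(((2 * 7 ^ 14 : ℕ) : ℤ) ^ 2 + (7 ^ 14 + 4 : ℕ) * (2 * 7 ^ 14 : ℕ)), 0,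
        ((7 ^ 14 + 4 : ℕ) : ℤ) * ((2 * 7 ^ 14 : ℕ) : ℤ) ^ 3, 0⟩ : WeierstrassCurve ℤ)).c₄ := by
  rw [FreyP6Engine.c₄_model]; norm_num

/-- `Δ(E₁) = 16a²c⁸b² = 3^4 · D` (`ord_3 b = 2`). [cite: SilvermanAEC2009, III.1 Table 3.1] -/
theorem Δ_eq_3 : ((
      ⟨0, -(((2 * 7 ^ 14 : ℕ) : ℤ) ^ 2 + (7 ^ 14 + 4 : ℕ) * (2 * 7 ^ 14 : ℕ)), 0,
        ((7 ^ 14 + 4 : ℕ) : ℤ) * ((2 * 7 ^ 14 : ℕ) : ℤ) ^ 3, 0⟩ : WeierstrassCurve ℤ)).Δ =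
      (3 : ℕ) ^ 4 * (16 * ((7 ^ 14 + 4 : ℕ) : ℤ) ^ 2 * ((2 * 7 ^ 14 : ℕ) : ℤ) ^ 8 * (75358119205 : ℤ) ^ 2) := by
  rw [FreyP6Engine.Δ_model]; norm_num

/-- `3 ∤ D`. [folklore] -/
theorem not_dvd_D_3 : ¬ ((3 : ℕ) : ℤ) ∣ (16 * ((7 ^ 14 + 4 : ℕ) : ℤ) ^ 2 * ((2 * 7 ^ 14 : ℕ) : ℤ) ^ 8 * (75358119205 : ℤ) ^ 2) := by
  norm_num

/-- `a_11(E₁) = 11 + 1 − #Ẽ₁(𝔽_11) = 11 + 1 − 16 = -4`: `E₁ mod 11 = [0, 10, 0, 5, 0]` (`decide +kernel`) and the point count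
`#Ẽ₁(𝔽_11) = 16` is a KERNEL computation (Euler's criterion, `card_sol_eq_sum_euler` / `natCard_point_eq_one_add_card`). [folklore] -/
theorem frobeniusTrace_11 : Literature.NumberTheory.Automorphic.frobeniusTrace
    (
      ⟨0, -(((2 * 7 ^ 14 : ℕ) : ℤ) ^ 2 + (7 ^ 14 + 4 : ℕ) * (2 * 7 ^ 14 : ℕ)), 0,
        ((7 ^ 14 + 4 : ℕ) : ℤ) * ((2 * 7 ^ 14 : ℕ) : ℤ) ^ 3, 0⟩ : WeierstrassCurve ℤ) 11 = -4 := by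
  have hm : ((
      ⟨0, -(((2 * 7 ^ 14 : ℕ) : ℤ) ^ 2 + (7 ^ 14 + 4 : ℕ) * (2 * 7 ^ 14 : ℕ)), 0,
        ((7 ^ 14 + 4 : ℕ) : ℤ) * ((2 * 7 ^ 14 : ℕ) : ℤ) ^ 3, 0⟩ : WeierstrassCurve ℤ)).map (Int.castRingHom (ZMod 11)) = ⟨0, 10, 0, 5, 0⟩ := by
    ext <;> decide +kernel
  have hc : Nat.card (⟨0, 10, 0, 5, 0⟩ : WeierstrassCurve (ZMod 11)).toAffine.Point = 16 := by
    rw [@WeierstrassCurve.natCard_point_eq_one_add_card (ZMod 11) (@ZMod.instField 11 ⟨by norm_num⟩) _ _ _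
      (by decide +kernel), @card_sol_eq_sum_euler (ZMod 11) (@ZMod.instField 11 ⟨by norm_num⟩) _ _
      (by rw [ZMod.ringChar_zmod_n]; decide)]
    decide +kernel
  rw [Literature.NumberTheory.Automorphic.frobeniusTrace, Literature.NumberTheory.Automorphic.numPointsMod,
    hm, hc]; norm_num

/-- `a_13(E₁) = 13 + 1 − #Ẽ₁(𝔽_13) = 13 + 1 − 8 = 6`: `E₁ mod 13 = [0, 9, 0, 5, 0]` (`decide +kernel`) and the point count
`#Ẽ₁(𝔽_13) = 8` is a KERNEL computation (Euler's criterion, `card_sol_eq_sum_euler` / `natCard_point_eq_one_add_card`). [folklore] -/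
theorem frobeniusTrace_13 : Literature.NumberTheory.Automorphic.frobeniusTrace
    (
      ⟨0, -(((2 * 7 ^ 14 : ℕ) : ℤ) ^ 2 + (7 ^ 14 + 4 : ℕ) * (2 * 7 ^ 14 : ℕ)), 0,
        ((7 ^ 14 + 4 : ℕ) : ℤ) * ((2 * 7 ^ 14 : ℕ) : ℤ) ^ 3, 0⟩ : WeierstrassCurve ℤ) 13 = 6 := by
  have hm : ((
      ⟨0, -(((2 * 7 ^ 14 : ℕ) : ℤ) ^ 2 + (7 ^ 14 + 4 : ℕ) * (2 * 7 ^ 14 : ℕ)), 0,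
        ((7 ^ 14 + 4 : ℕ) : ℤ) * ((2 * 7 ^ 14 : ℕ) : ℤ) ^ 3, 0⟩ : WeierstrassCurve ℤ)).map (Int.castRingHom (ZMod 13)) = ⟨0, 9, 0, 5, 0⟩ := by
    ext <;> decide +kernel
  have hc : Nat.card (⟨0, 9, 0, 5, 0⟩ : WeierstrassCurve (ZMod 13)).toAffine.Point = 8 := by
    rw [@WeierstrassCurve.natCard_point_eq_one_add_card (ZMod 13) (@ZMod.instField 13 ⟨by norm_num⟩) _ _ _
      (by decide +kernel), @card_sol_eq_sum_euler (ZMod 13) (@ZMod.instField 13 ⟨by norm_num⟩) _ _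
      (by rw [ZMod.ringChar_zmod_n]; decide)]
    decide +kernel
  rw [Literature.NumberTheory.Automorphic.frobeniusTrace, Literature.NumberTheory.Automorphic.numPointsMod,
    hm, hc]; norm_num

/-- **(P6) at `ratPoint (((7 ^ 14 + 4 : ℕ) : ℚ) / (2 * 7 ^ 14 : ℕ))` for `l ∈ [11, 239]`** —
multiplicative prime `3` (`ord Δ = 4`), Frobenius certificate `p = 13` (`a_13 = 6`; `X² − a_13X + 13` rootless mod each
listed `l`, ONE kernel `decide` over `ℕ`). [cite: Mochizuki2012, IUTchIV Cor. 2.2 (ii) (P6) p.46] -/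
theorem condP6_of_mem_q3_p13 :
    ∀ l ∈ ([11, 239] : List ℕ),
      Cor22.CondP6 (ratPoint (((7 ^ 14 + 4 : ℕ) : ℚ) / (2 * 7 ^ 14 : ℕ))) l :=
  FreyP6Engine.condP6_ratPoint_of_certificate_list (7 ^ 14 + 4) (2 * 7 ^ 14) (by norm_num) (by norm_num) (by norm_num)
    3 (by norm_num) not_dvd_c₄_3 4 (by norm_num) _ Δ_eq_3 not_dvd_D_3 13 (by norm_num) (by rw [FreyP6Engine.Δ_model]; norm_num) 6 frobeniusTrace_13
    [11, 239] (by decide +kernel) (by decide +kernel)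

/-- **(P6) at `ratPoint (((7 ^ 14 + 4 : ℕ) : ℚ) / (2 * 7 ^ 14 : ℕ))` for `l ∈ [13, 17, 19]`** —
multiplicative prime `3` (`ord Δ = 4`), Frobenius certificate `p = 11` (`a_11 = -4`; `X² − a_11X + 11` rootless mod each
listed `l`, ONE kernel `decide` over `ℕ`). [cite: Mochizuki2012, IUTchIV Cor. 2.2 (ii) (P6) p.46] -/
theorem condP6_of_mem_q3_p11 :
    ∀ l ∈ ([13, 17, 19] : List ℕ),
      Cor22.CondP6 (ratPoint (((7 ^ 14 + 4 : ℕ) : ℚ) / (2 * 7 ^ 14 : ℕ))) l :=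
  FreyP6Engine.condP6_ratPoint_of_certificate_list (7 ^ 14 + 4) (2 * 7 ^ 14) (by norm_num) (by norm_num) (by norm_num)
    3 (by norm_num) not_dvd_c₄_3 4 (by norm_num) _ Δ_eq_3 not_dvd_D_3 11 (by norm_num) (by rw [FreyP6Engine.Δ_model]; norm_num) (-4) frobeniusTrace_11
    [13, 17, 19] (by decide +kernel) (by decide +kernel)

/-- **(P6) HOLDS at `ratPoint (((7 ^ 14 + 4 : ℕ) : ℚ) / (2 * 7 ^ 14 : ℕ))` for EVERY tabulated `l`** of the R-W WINDOW-TABLE at this datum (5 primes,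
`11 ≤ l ≤ 239`): `Cor22.CondP6 (ratPoint λ) l` — the image of `Gal(F̄/F)` on `E_F[l]` contains `SL₂(𝔽_l)` for every theta-field `F`.
Certificate primes [11, 13]; multiplicative prime(s) [3]. [cite: Mochizuki2012, IUTchIV Cor. 2.2 (ii) (P6) p.46] -/
theorem condP6_tabulated' :
    ∀ l ∈ ([11, 13, 17, 19, 239] : List ℕ),
      Cor22.CondP6 (ratPoint (((7 ^ 14 + 4 : ℕ) : ℚ) / (2 * 7 ^ 14 : ℕ))) l := by
  have hsplit : ∀ l ∈ ([11, 13, 17, 19, 239] : List ℕ),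
      l ∈ ([11, 239] : List ℕ) ∨
      l ∈ ([13, 17, 19] : List ℕ) := by
    decide +kernel
  intro l hl
  rcases hsplit l hl with h | h
  · exact condP6_of_mem_q3_p13 l h
  · exact condP6_of_mem_q3_p11 l h

/-- **(P6) at `ratPoint ((2 : ℚ)⁻¹ + 2 / 7 ^ 14)`** — the tree's spelling of this datum (`(2 : ℚ)⁻¹ + 2 / 7 ^ 14 = (7 ^ 14 + 4)/(2 * 7 ^ 14)`, `norm_num`) — for every
tabulated `l`: `condP6_tabulated'` transported along the equality of the rational numbers. [cite: Mochizuki2012, IUTchIV Cor. 2.2 (ii) (P6) p.46] -/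
theorem condP6_tabulated :
    ∀ l ∈ ([11, 13, 17, 19, 239] : List ℕ),
      Cor22.CondP6 (ratPoint ((2 : ℚ)⁻¹ + 2 / 7 ^ 14)) l := by
  have hq : ((2 : ℚ)⁻¹ + 2 / 7 ^ 14) = (((7 ^ 14 + 4 : ℕ) : ℚ) / (2 * 7 ^ 14 : ℕ)) := by norm_num
  rw [hq]
  exact condP6_tabulated'

end FreyP6Hex14
end Summit.ABC.IUTFork.Conditional

end
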